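import Summits.RiemannHypothesis.RiemannHypothesis.Theorems.PfPersistenceMarkovCore
import HarnessLib

/-!
# PF persistence (theory 1, edge law): THE MARKOV CORE OF A NON-NEGATIVE WEIGHT TABLE, IX —
# the dial law of the core bottom (monotone, concave, Lipschitz in the table)

Helper file (`--supports stmt-RiemannHypothesis-19953`); mechanism/rigidity campaign; no RH claims.
Ninth file of the chain `PfPersistenceMarkovCore*`.  The first eight files establish kernel
Perron–Frobenius for the Markov core `tableDirichletEnergy a w` of every table `w ≥ 0` on the prime
index of the window (`CorePerronFrobenius w a`).  This file records how the BOTTOM of the core,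
`coreBottom w a = inf {𝓔^w_a(f) : f ∈ coreAdm a, ‖f‖₂ = 1}`, responds to the cell's table edits
(dials `w ↦ K·w`, deletions `w ↦ 1_S·w`, convex interpolation between tables): the energy is AFFINE and
MONOTONE in the table and `4‖f‖₂²`-Lipschitz per unit of `tableDist` (since `0 ≤ D_t(f) ≤ 4‖f‖₂²`),
and the finite-energy class `coreAdm a` does not depend on the table, so the bottom — an infimum of
affine functions of `w` over a fixed set — is

* MONOTONE: `w ≤ w'` on the index ⇒ `coreBottom w a ≤ coreBottom w' a` (`coreBottom_mono_table`);
* CONCAVE along every segment of non-negative tables (`coreBottom_convex_comb_ge`,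
  `concaveOn_coreBottom_segment`);
* 4-LIPSCHITZ for the table distance: `|coreBottom w a − coreBottom w' a| ≤ 4 · tableDist a w w'`
  (`abs_coreBottom_sub_le`).

Consequences (all PROVED, RH-free, operator-free, for every window `a > 0`): the arch-only core
(`w = 0`) is the FLOOR of the class and every table's bottom exceeds it by at most `4 Σ_{index} w n`
(`coreBottom_archOnly_le`, `coreBottom_le_archOnly_add`); a deletion or a dial-down can only LOWER the
bottom, by at most `4 ×` the removed mass (`coreBottom_indicator_le`, `coreBottom_le_indicator_add`,
`coreBottom_dial_le`, `coreBottom_le_dial`).  Like everything in this chain these are statements about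
the CONTINUUM core of the whole non-negative-table class; they hold for ζ's table and for every control
alike and therefore carry no discriminating content (twin wall: the bottom depends on the table only
through its values on `weilPrimeIndex a`, `tableDirichletEnergy_congr_table` in file VII).

## References

* M. Reed, B. Simon, *Methods of Modern Mathematical Physics IV* (1978), §XIII.12 (min–max; the ground
  energy as an infimum of the form over a form core).
* E. H. Lieb, M. Loss, *Analysis*, 2nd ed. (2001), Thm 7.8 and §11 (concavity of the ground-state
  energy in the potential: an infimum of affine functionals).
* E. Bombieri, Rend. Mat. Acc. Lincei (9) 11 (2000) 183–233, Thm 2 (the windowed explicit formula).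
-/

set_option linter.dupNamespace false

noncomputable section

open MeasureTheory Set Filter
open scoped Topology ENNReal NNReal

namespace Summit.RiemannHypothesis.RiemannHypothesis.Theorems.PfPersistence

open Literature.NumberTheory.LFunctions

variable {a : ℝ} {w w' : ℕ → ℝ}

/-! ## §1 The energy as a function of the table: affine, monotone, Lipschitz -/

/-- **Difference of the energies of two tables**:
`𝓔^w_a(f) − 𝓔^{w'}_a(f) = Σ_{log n < 2a} (w n − w' n) D_{log n}(f)` (the archimedean part cancels).
[folklore] -/
theorem tableDirichletEnergy_sub_table (a : ℝ) (w w' : ℕ → ℝ) (f : ℝ → ℂ) :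
    tableDirichletEnergy a w f - tableDirichletEnergy a w' f =
      ∑ n ∈ weilPrimeIndex a, (w n - w' n) * weilIncrement f (Real.log n) := by
  unfold tableDirichletEnergy
  rw [add_sub_add_right_eq_sub, ← Finset.sum_sub_distrib]
  exact Finset.sum_congr rfl fun n _ ↦ by ring

/-- **The energy is monotone in the table**: `w ≤ w'` on the prime index of the window ⇒
`𝓔^w_a(f) ≤ 𝓔^{w'}_a(f)` for every `f` (each `D_{log n}(f) ≥ 0`). [folklore] -/
theorem tableDirichletEnergy_mono_table (h : ∀ n ∈ weilPrimeIndex a, w n ≤ w' n) (f : ℝ → ℂ) :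
    tableDirichletEnergy a w f ≤ tableDirichletEnergy a w' f := by
  rw [← sub_nonneg, tableDirichletEnergy_sub_table]
  exact Finset.sum_nonneg fun n hn ↦ mul_nonneg (sub_nonneg.2 (h n hn)) (weilIncrement_nonneg f _)

/-- **The energy is affine in the table**: along the segment `(1 − t)·w + t·w'`,
`𝓔^{(1−t)w + t w'}_a(f) = (1 − t) 𝓔^w_a(f) + t 𝓔^{w'}_a(f)`. [folklore] -/
theorem tableDirichletEnergy_convex_comb (a : ℝ) (w w' : ℕ → ℝ) (t : ℝ) (f : ℝ → ℂ) :
    tableDirichletEnergy a (fun n ↦ (1 - t) * w n + t * w' n) f =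
      (1 - t) * tableDirichletEnergy a w f + t * tableDirichletEnergy a w' f := by
  unfold tableDirichletEnergy
  have hs : ∑ n ∈ weilPrimeIndex a, ((1 - t) * w n + t * w' n) * weilIncrement f (Real.log n) =
      (1 - t) * ∑ n ∈ weilPrimeIndex a, w n * weilIncrement f (Real.log n) +
        t * ∑ n ∈ weilPrimeIndex a, w' n * weilIncrement f (Real.log n) := by
    rw [Finset.mul_sum, Finset.mul_sum, ← Finset.sum_add_distrib]
    exact Finset.sum_congr rfl fun n _ ↦ by ring
  rw [hs]
  ring

/-- **The energy is Lipschitz in the table**: `|𝓔^w_a(f) − 𝓔^{w'}_a(f)| ≤ 4‖f‖₂² · tableDist a w w'`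
for `f ∈ L²`, from `0 ≤ D_t(f) ≤ 4‖f‖₂²` (`weilIncrement_le_four_mul_of_memLp`). [folklore] -/
theorem abs_tableDirichletEnergy_sub_le {f : ℝ → ℂ} (hf : MemLp f 2) (a : ℝ) (w w' : ℕ → ℝ) :
    |tableDirichletEnergy a w f - tableDirichletEnergy a w' f| ≤
      4 * (∫ x, ‖f x‖ ^ 2) * tableDist a w w' := by
  rw [tableDirichletEnergy_sub_table, tableDist, Finset.mul_sum]
  refine (Finset.abs_sum_le_sum_abs _ _).trans (Finset.sum_le_sum fun n _ ↦ ?_)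
  rw [abs_mul, abs_of_nonneg (weilIncrement_nonneg f _), mul_comm (4 * _)]
  exact mul_le_mul_of_nonneg_left (weilIncrement_le_four_mul_of_memLp hf _) (abs_nonneg _)

/-! ## §2 The dial law of the core bottom -/

/-- **The core bottom is monotone in the table**: for `0 ≤ w ≤ w'` on the prime index of the window,
`coreBottom w a ≤ coreBottom w' a` (`a > 0`). [folklore] -/
theorem coreBottom_mono_table (hw : ∀ n ∈ weilPrimeIndex a, 0 ≤ w n)
    (h : ∀ n ∈ weilPrimeIndex a, w n ≤ w' n) (ha : 0 < a) :
    coreBottom w a ≤ coreBottom w' a := by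
  refine le_csInf (coreSet_nonempty w' ha) ?_
  rintro _ ⟨f, hf, hn, rfl⟩
  exact (coreBottom_le hw hf hn).trans (tableDirichletEnergy_mono_table h f)

/-- **The core bottom is concave in the table**: for non-negative tables `w, w'` and `t ∈ [0, 1]`,
`(1 − t) coreBottom w a + t coreBottom w' a ≤ coreBottom ((1 − t)w + t w') a` — an infimum of affine
functions of the table over the table-independent class `coreAdm a`. [folklore] -/
theorem coreBottom_convex_comb_ge (hw : ∀ n ∈ weilPrimeIndex a, 0 ≤ w n)
    (hw' : ∀ n ∈ weilPrimeIndex a, 0 ≤ w' n) {t : ℝ} (ht₀ : 0 ≤ t) (ht₁ : t ≤ 1) (ha : 0 < a) :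
    (1 - t) * coreBottom w a + t * coreBottom w' a ≤
      coreBottom (fun n ↦ (1 - t) * w n + t * w' n) a := by
  refine le_csInf (coreSet_nonempty _ ha) ?_
  rintro _ ⟨f, hf, hn, rfl⟩
  rw [tableDirichletEnergy_convex_comb]
  exact add_le_add (mul_le_mul_of_nonneg_left (coreBottom_le hw hf hn) (sub_nonneg.2 ht₁))
    (mul_le_mul_of_nonneg_left (coreBottom_le hw' hf hn) ht₀)

/-- **Concavity along segments, Mathlib form**: `t ↦ coreBottom ((1 − t)w + t w') a` is concave on
`[0, 1]` for non-negative tables `w, w'`. [folklore] -/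
theorem concaveOn_coreBottom_segment (hw : ∀ n ∈ weilPrimeIndex a, 0 ≤ w n)
    (hw' : ∀ n ∈ weilPrimeIndex a, 0 ≤ w' n) (ha : 0 < a) :
    ConcaveOn ℝ (Icc (0 : ℝ) 1) fun t ↦ coreBottom (fun n ↦ (1 - t) * w n + t * w' n) a := by
  refine ⟨convex_Icc 0 1, ?_⟩
  intro x hx y hy p q hp hq hpq
  have hWx : ∀ n ∈ weilPrimeIndex a, 0 ≤ (1 - x) * w n + x * w' n := fun n hn ↦
    add_nonneg (mul_nonneg (sub_nonneg.2 hx.2) (hw n hn)) (mul_nonneg hx.1 (hw' n hn))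
  have hWy : ∀ n ∈ weilPrimeIndex a, 0 ≤ (1 - y) * w n + y * w' n := fun n hn ↦
    add_nonneg (mul_nonneg (sub_nonneg.2 hy.2) (hw n hn)) (mul_nonneg hy.1 (hw' n hn))
  have hq₁ : q ≤ 1 := by linarith
  have key := coreBottom_convex_comb_ge hWx hWy hq hq₁ ha
  have hp' : p = 1 - q := by linarith
  have hfun : (fun n ↦ (1 - (p • x + q • y)) * w n + (p • x + q • y) * w' n) =
      fun n ↦ (1 - q) * ((1 - x) * w n + x * w' n) + q * ((1 - y) * w n + y * w' n) := by
    funext n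
    simp only [smul_eq_mul, hp']
    ring
  simp only [smul_eq_mul] at hfun ⊢
  rw [hfun, hp']
  exact key

/-- **One-sided Lipschitz bound**: `coreBottom w a ≤ coreBottom w' a + 4 · tableDist a w w'` for a
non-negative table `w` and ANY table `w'` (`a > 0`). [folklore] -/
theorem coreBottom_le_coreBottom_add (hw : ∀ n ∈ weilPrimeIndex a, 0 ≤ w n) (w' : ℕ → ℝ)
    (ha : 0 < a) : coreBottom w a ≤ coreBottom w' a + 4 * tableDist a w w' := by
  have h : coreBottom w a - 4 * tableDist a w w' ≤ coreBottom w' a := by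
    refine le_csInf (coreSet_nonempty _ ha) ?_
    rintro _ ⟨f, hf, hn, rfl⟩
    have h₁ := coreBottom_le hw hf hn
    have h₂ := abs_tableDirichletEnergy_sub_le hf.1 a w w'
    rw [hn, mul_one] at h₂
    have h₃ := (abs_sub_le_iff.1 h₂).1
    linarith
  linarith

/-- **The core bottom is 4-Lipschitz in the table**:
`|coreBottom w a − coreBottom w' a| ≤ 4 · tableDist a w w' = 4 Σ_{log n < 2a} |w n − w' n|` for
non-negative tables (`a > 0`). [folklore] -/
theorem abs_coreBottom_sub_le (hw : ∀ n ∈ weilPrimeIndex a, 0 ≤ w n)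
    (hw' : ∀ n ∈ weilPrimeIndex a, 0 ≤ w' n) (ha : 0 < a) :
    |coreBottom w a - coreBottom w' a| ≤ 4 * tableDist a w w' := by
  rw [abs_sub_le_iff]
  constructor
  · linarith [coreBottom_le_coreBottom_add hw w' ha]
  · linarith [coreBottom_le_coreBottom_add hw' w ha, tableDist_comm a w w']

/-! ## §3 Consequences: the arch-only floor, deletions, dials -/

/-- **The arch-only core is the floor of the class**: `coreBottom 0 a ≤ coreBottom w a` for every
non-negative table (`a > 0`). [folklore] -/
theorem coreBottom_archOnly_le (hw : ∀ n ∈ weilPrimeIndex a, 0 ≤ w n) (ha : 0 < a) :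
    coreBottom (fun _ ↦ (0 : ℝ)) a ≤ coreBottom w a :=
  coreBottom_mono_table (fun _ _ ↦ le_rfl) hw ha

/-- … and every table's bottom exceeds the floor by at most `4 Σ_{log n < 2a} w n`. [folklore] -/
theorem coreBottom_le_archOnly_add (hw : ∀ n ∈ weilPrimeIndex a, 0 ≤ w n) (ha : 0 < a) :
    coreBottom w a ≤ coreBottom (fun _ ↦ (0 : ℝ)) a + 4 * ∑ n ∈ weilPrimeIndex a, w n := by
  have h := coreBottom_le_coreBottom_add hw (fun _ ↦ (0 : ℝ)) ha
  have hd : tableDist a w (fun _ ↦ (0 : ℝ)) = ∑ n ∈ weilPrimeIndex a, w n :=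
    Finset.sum_congr rfl fun n hn ↦ by rw [sub_zero, abs_of_nonneg (hw n hn)]
  rwa [hd] at h

/-- **Deleting primes can only lower the bottom**: `coreBottom (1_S · w) a ≤ coreBottom w a`.
[folklore] -/
theorem coreBottom_indicator_le (hw : ∀ n ∈ weilPrimeIndex a, 0 ≤ w n) (S : Set ℕ) (ha : 0 < a) :
    coreBottom (S.indicator w) a ≤ coreBottom w a :=
  coreBottom_mono_table (fun n hn ↦ Set.indicator_apply_nonneg fun _ ↦ hw n hn)
    (fun n hn ↦ Set.indicator_apply_le' (fun _ ↦ le_rfl) fun _ ↦ hw n hn) ha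

/-- … by at most `4 ×` the deleted mass: `coreBottom w a ≤ coreBottom (1_S · w) a + 4 Σ_{index ∖ S} w n`.
[folklore] -/
theorem coreBottom_le_indicator_add (hw : ∀ n ∈ weilPrimeIndex a, 0 ≤ w n) (S : Set ℕ)
    (ha : 0 < a) :
    coreBottom w a ≤ coreBottom (S.indicator w) a + 4 * ∑ n ∈ weilPrimeIndex a, Sᶜ.indicator w n := by
  have h := coreBottom_le_coreBottom_add hw (S.indicator w) ha
  have hd : tableDist a w (S.indicator w) = ∑ n ∈ weilPrimeIndex a, Sᶜ.indicator w n := by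
    refine Finset.sum_congr rfl fun n hn ↦ ?_
    rw [Set.indicator_compl, Pi.sub_apply]
    exact abs_of_nonneg (sub_nonneg.2 (Set.indicator_apply_le' (fun _ ↦ le_rfl) fun _ ↦ hw n hn))
  rwa [hd] at h

/-- **Dialling down lowers the bottom**: `0 ≤ K ≤ 1` ⇒ `coreBottom (K · w) a ≤ coreBottom w a`.
[folklore] -/
theorem coreBottom_dial_le (hw : ∀ n ∈ weilPrimeIndex a, 0 ≤ w n) {K : ℕ → ℝ}
    (hK : ∀ n, 0 ≤ K n ∧ K n ≤ 1) (ha : 0 < a) :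
    coreBottom (fun n ↦ K n * w n) a ≤ coreBottom w a :=
  coreBottom_mono_table (fun n hn ↦ mul_nonneg (hK n).1 (hw n hn))
    (fun n hn ↦ mul_le_of_le_one_left (hw n hn) (hK n).2) ha

/-- **Dialling up raises the bottom**: `1 ≤ K` ⇒ `coreBottom w a ≤ coreBottom (K · w) a`. [folklore] -/
theorem coreBottom_le_dial (hw : ∀ n ∈ weilPrimeIndex a, 0 ≤ w n) {K : ℕ → ℝ}
    (hK : ∀ n, 1 ≤ K n) (ha : 0 < a) :
    coreBottom w a ≤ coreBottom (fun n ↦ K n * w n) a :=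
  coreBottom_mono_table hw (fun n hn ↦ le_mul_of_one_le_left (hw n hn) (hK n)) ha

/-- **A dial moves the bottom by at most `4 Σ |K n − 1| w n`**. [folklore] -/
theorem abs_coreBottom_dial_sub_le (hw : ∀ n ∈ weilPrimeIndex a, 0 ≤ w n) {K : ℕ → ℝ}
    (hK : ∀ n, 0 ≤ K n) (ha : 0 < a) :
    |coreBottom (fun n ↦ K n * w n) a - coreBottom w a| ≤
      4 * ∑ n ∈ weilPrimeIndex a, |K n - 1| * w n := by
  have h := abs_coreBottom_sub_le (fun n hn ↦ mul_nonneg (hK n) (hw n hn)) hw ha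
  have hd : tableDist a (fun n ↦ K n * w n) w = ∑ n ∈ weilPrimeIndex a, |K n - 1| * w n :=
    Finset.sum_congr rfl fun n hn ↦ by
      rw [show K n * w n - w n = (K n - 1) * w n by ring, abs_mul, abs_of_nonneg (hw n hn)]
  rwa [hd] at h

end Summit.RiemannHypothesis.RiemannHypothesis.Theorems.PfPersistence

end
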